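import Literature.AlgebraicGeometry.ShimuraVarieties.UnitaryBallQuotientDatum
import Literature.GroupTheory.ArithmeticGroups.NeatSubgroups
import HarnessLib

/-!
# Principal congruence subgroups of level `n ≥ 3` of `U(V)(F)` are neat

Family `hodge`, layer `Literature/AlgebraicGeometry/ShimuraVarieties`; theorems only (no definition,
no named fact; D-0026). Junction of `GroupTheory/ArithmeticGroups/NeatSubgroups` (BOREL's
Proposition 17.4: `Γ(q)` is NEAT for `q ≥ 3`, [Borel1969, Prop. 17.4], [Schwermer2010, §4.3]) with
the Layer-C carrier `ShimuraVarieties.principalCongruenceSubgroup σ H n ≤ U(H)(E) ≤ GL_m(E)` of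
[BergeronMillsonMoeglin2016Balls, Part 2 §1.4] ("`K` neat, whence `Γ` torsion free"), whose
hypothesis structure `UnitaryBallQuotientDatum` so far only recorded the CONSEQUENCE `torsionFree`
(`PrincipalCongruenceSubgroupTorsionFree`, MINKOWSKI). Here:

* `IsCongruentOneMod.isNeat` — `g ≡ 1 (mod n)` integrally (`g = 1 + n·A`, `A ∈ M_m(𝓞_E)`), `n ≥ 3`
  ⟹ `g` is neat with respect to every field `L ⊇ E` of characteristic zero;
* `neat_principalCongruenceSubgroup` / `neat_of_le_principalCongruenceSubgroup` — `Γ(n)` and all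
  its subgroups are NEAT subgroups for `n ≥ 3` (BMM's standing hypothesis in its printed form);
* `torsionFree_of_forall_isNeat` — "`K` neat, whence `Γ` torsion free": a subgroup of `GL_m(E)` all
  of whose elements are neat (eigenvalues in an algebraically closed `L ⊇ E`, e.g. `L = ℂ` for
  `E ⊂ ℂ`) is torsion-free — so `neat_principalCongruenceSubgroup` refines
  `torsionFree_principalCongruenceSubgroup`.

## References

* [Borel1969] A. Borel, Introduction aux groupes arithmétiques (1969), §17.1, Prop. 17.4.
* [Schwermer2010] J. Schwermer, Bull. AMS 47 (2010), §4.3 Proposition p. 208.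
* [BergeronMillsonMoeglin2016Balls] N. Bergeron, J. Millson, C. Moeglin, Acta Math. 216 (2016),
  Part 2 §1.4.
-/

namespace Literature.AlgebraicGeometry.ShimuraVarieties

open Literature.GroupTheory.ArithmeticGroups

variable {E : Type*} [Field E] [NumberField E] {m : Type*} [Fintype m] [DecidableEq m]

/-- **`g ≡ 1 (mod n)` integrally with `n ≥ 3` ⟹ `g` neat** (with respect to every field `L ⊇ E`
of characteristic zero): the number-field form of Borel's Proposition 17.4 on the tree's predicate
`IsCongruentOneMod`. [cite: Borel1969, Prop. 17.4] [cite: Schwermer2010, §4.3 Proposition p. 208] -/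
theorem IsCongruentOneMod.isNeat {n : ℕ} (hn : 3 ≤ n) {g : Matrix m m E}
    (hg : IsCongruentOneMod n g) (L : Type*) [Field L] [CharZero L] [Algebra E L] :
    IsNeat L g :=
  isNeat_of_exists_eq_one_add_smul_map hn hg L

/-- **The principal congruence subgroup `Γ(n) ≤ U(H)(E)` is NEAT for `n ≥ 3`**: every
`γ ∈ Γ(n)` is a neat matrix ("`K` neat", the standing level hypothesis of BMM, in Borel's sense).
[cite: Borel1969, Prop. 17.4] [cite: BergeronMillsonMoeglin2016Balls, Part 2 §1.4] -/
theorem neat_principalCongruenceSubgroup (σ : E →+* E) (H : Matrix m m E) {n : ℕ} (hn : 3 ≤ n)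
    (L : Type*) [Field L] [CharZero L] [Algebra E L] :
    ∀ γ ∈ principalCongruenceSubgroup σ H n, IsNeat L ((γ : GL m E) : Matrix m m E) :=
  fun _ hγ => hγ.2.1.isNeat hn L

/-- **Every subgroup `Γ ≤ Γ(n)`, `n ≥ 3`, is neat.** [cite: Borel1969, Prop. 17.4]
[cite: BergeronMillsonMoeglin2016Balls, Part 2 §1.4] -/
theorem neat_of_le_principalCongruenceSubgroup {σ : E →+* E} {H : Matrix m m E} {n : ℕ}
    (hn : 3 ≤ n) {Γ : Subgroup (GL m E)} (hΓ : Γ ≤ principalCongruenceSubgroup σ H n)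
    (L : Type*) [Field L] [CharZero L] [Algebra E L] :
    ∀ γ ∈ Γ, IsNeat L ((γ : GL m E) : Matrix m m E) :=
  fun γ hγ => neat_principalCongruenceSubgroup σ H hn L γ (hΓ hγ)

omit [NumberField E] in
/-- **"`K` neat, whence `Γ` torsion free"**: a subgroup `Γ ≤ GL_m(E)` all of whose elements are
neat — eigenvalues taken in an algebraically closed field `L ⊇ E` of characteristic zero (for
`E ⊂ ℂ` as in `UnitaryBallQuotientDatum`, `L = ℂ`) — is torsion-free: the `torsionFree` clause of
`UnitaryBallQuotientDatum` follows from neatness. [cite: BergeronMillsonMoeglin2016Balls, Part 2 §1.4]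
[cite: Schwermer2010, §4.3 p. 208] -/
theorem torsionFree_of_forall_isNeat {Γ : Subgroup (GL m E)} (L : Type*) [Field L] [IsAlgClosed L]
    [CharZero L] [Algebra E L] (hΓ : ∀ γ ∈ Γ, IsNeat L ((γ : GL m E) : Matrix m m E)) :
    ∀ γ ∈ Γ, IsOfFinOrder γ → γ = 1 :=
  torsionFree_of_neat (algebraMap E L).injective hΓ

end Literature.AlgebraicGeometry.ShimuraVarieties
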